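import Summits.Ventures.PackingBounds.Configurations.LeechEnergy
import Summits.Ventures.PackingBounds.Configurations.DesignSlackness

/-!
# Distance-regularity of `196560`-point kissing configurations in `ℝ²⁴` (Bannai–Sloane, per point)

Framing: lottery ticket; floor = certified bounds/negative ranges. Venture `PackingBounds` (cell
`pub-packcert`, seat `pub-packcert-energy`).

`Configurations/LeechEnergy.lean` fixes the TOTAL pair counts of any `196560`-point kissing configuration
`C ⊂ S²³`. Here the same is proved AROUND EVERY POINT: each `x ∈ C` has exactly `4600` neighbours at
inner product `1/2`, `47104` at `1/4`, `93150` at `0`, `47104` at `-1/4`, `4600` at `-1/2` and one antipode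
(`nbrCount_eq`) — i.e. `C` is distance-invariant with the Leech parameters, the hypothesis of the
Bannai–Sloane uniqueness theorem. The extra input is a **weighted** complementary-slackness step: the
Gegenbauer matrices `[C_k(⟨x,y⟩)]_{x,y ∈ C}` are positive semidefinite
(`Literature…sum_mul_gegenbauerHom_nonneg`, the addition theorem), and a positive semidefinite symmetric
matrix whose total sum vanishes has all row sums zero (`DesignSlackness.rowSum_eq_zero_of_psd`); hence
`Σ_{y ∈ C} C_k^{(11)}(⟨x,y⟩) = 0` for every `x ∈ C` and `1 ≤ k ≤ 10` (`pointMoment_eq_zero`: `C` is a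
spherical `10`-design in the per-point sense), and the six neighbour counts of `x` solve the same
nonsingular `6 × 6` system as in `LeechEnergy`.

## References
* E. Bannai, N. J. A. Sloane, Canad. J. Math. 33 (1981) 437–449, Theorem 3 and its proof (= Conway–Sloane,
  *SPLAG*, Ch. 14 §§2–4). [`ConwaySloane1999`]
* P. Delsarte, J.-M. Goethals, J. J. Seidel, Geom. Dedicata 6 (1977) 363–388, §4 (designs from LP equality).
-/

namespace Summit.Ventures.PackingBounds.Config.Leech

open Finset Literature.Analysis.SpecialFunctions Literature.Geometry.DiscreteGeometry

local notation "E24" => EuclideanSpace ℝ (Fin 24)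

/-! ### Per-point design property and neighbour counts -/

/-- Number of points of `C` other than `x` with inner product `t` with `x`. -/
noncomputable def nbrCount (C : Finset E24) (x : E24) (t : ℝ) : ℕ :=
  ((C.erase x).filter fun y => inner ℝ x y = t).card

section perpoint

variable {C : Finset E24} (h1 : ∀ x ∈ C, ‖x‖ = 1)
  (h2 : ∀ x ∈ C, ∀ y ∈ C, x ≠ y → inner ℝ x y ≤ 1 / 2) (hcard : C.card = 196560)
include h1 h2 hcard

/-- **Per-point design property**: `Σ_{y ∈ C} C_k^{(11)}(⟨x, y⟩) = 0` for every `x ∈ C`, `1 ≤ k ≤ 10`.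
[cite: ConwaySloane1999, Ch. 14 §3] -/
theorem pointMoment_eq_zero {k : ℕ} (hk1 : 1 ≤ k) (hk2 : k ≤ 10) {x : E24} (hx : x ∈ C) :
    ∑ y ∈ C, gegenbauerSum (11 : ℝ) k (inner ℝ x y) = 0 :=
  DesignSlackness.pointMoment_eq_zero_of_total (n := 24) (μ := 11) (by norm_num) (by norm_num) C h1 k
    (Kissing.kissing_dim24_moments_of_card_eq_196560 C h1 h2 hcard hk1 hk2) hx

/-- Per-point off-diagonal moments. -/
theorem pointMoment_erase {k : ℕ} (hk1 : 1 ≤ k) (hk2 : k ≤ 10) {x : E24} (hx : x ∈ C) :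
    ∑ y ∈ C.erase x, gegenbauerSum (11 : ℝ) k (inner ℝ x y) = -gegenbauerSum 11 k 1 := by
  have h := pointMoment_eq_zero h1 h2 hcard hk1 hk2 hx
  rw [← Finset.add_sum_erase C _ hx, real_inner_self_eq_norm_sq, h1 x hx, one_pow] at h
  linarith

/-- Every sum over the other points is a combination of the six neighbour counts. -/
theorem sum_erase_eq_sum_nbrCount (g : ℝ → ℝ) {x : E24} (hx : x ∈ C) :
    ∑ y ∈ C.erase x, g (inner ℝ x y) = ∑ t ∈ T6, (nbrCount C x t : ℝ) * g t := by
  have hmaps : ∀ y ∈ C.erase x, inner ℝ x y ∈ T6 := by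
    intro y hy
    obtain ⟨hne, hyC⟩ := Finset.mem_erase.mp hy
    have h := Kissing.kissing_dim24_inner_of_card_eq_196560 C h1 h2 hcard hx hyC (Ne.symm hne)
    simp only [T6, mem_insert, mem_singleton]
    rcases h with h | h | h | h | h | h <;> simp [h]
  rw [← Finset.sum_fiberwise_of_maps_to hmaps]
  refine Finset.sum_congr rfl fun t _ => ?_
  rw [nbrCount, ← nsmul_eq_mul, ← Finset.sum_const]
  exact Finset.sum_congr rfl fun y hy => by rw [(Finset.mem_filter.mp hy).2]

/-- **Distance-regularity of `196560`-point kissing configurations in `ℝ²⁴`**: every point has exactly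
`1, 4600, 47104, 93150, 47104, 4600` other points at inner product `-1, -1/2, -1/4, 0, 1/4, 1/2`.
[cite: ConwaySloane1999, Ch. 14 Thm. 3] -/
theorem nbrCount_eq {x : E24} (hx : x ∈ C) :
    nbrCount C x (-1) = 1 ∧ nbrCount C x (-1 / 2) = 4600 ∧ nbrCount C x (-1 / 4) = 47104 ∧
      nbrCount C x 0 = 93150 ∧ nbrCount C x (1 / 4) = 47104 ∧ nbrCount C x (1 / 2) = 4600 := by
  have e0 := sum_erase_eq_sum_nbrCount h1 h2 hcard (fun _ => (1 : ℝ)) hx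
  have e0' : ∑ y ∈ C.erase x, (fun _ => (1 : ℝ)) (inner ℝ x y) = 196559 := by
    rw [Finset.sum_const, Finset.card_erase_of_mem hx, hcard]; norm_num
  have e1 := sum_erase_eq_sum_nbrCount h1 h2 hcard (gegenbauerSum 11 1) hx
  have e2 := sum_erase_eq_sum_nbrCount h1 h2 hcard (gegenbauerSum 11 2) hx
  have e3 := sum_erase_eq_sum_nbrCount h1 h2 hcard (gegenbauerSum 11 3) hx
  have e4 := sum_erase_eq_sum_nbrCount h1 h2 hcard (gegenbauerSum 11 4) hx
  have e5 := sum_erase_eq_sum_nbrCount h1 h2 hcard (gegenbauerSum 11 5) hx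
  rw [pointMoment_erase h1 h2 hcard (by norm_num) (by norm_num) hx] at e1 e2 e3 e4 e5
  rw [e0'] at e0
  rw [sum_T6] at e0 e1 e2 e3 e4 e5
  simp only [gegenbauerSum_11_1, gegenbauerSum_11_2, gegenbauerSum_11_3, gegenbauerSum_11_4,
    gegenbauerSum_11_5] at e1 e2 e3 e4 e5
  set a := (nbrCount C x (-1) : ℝ) with ha
  set b := (nbrCount C x (-1 / 2) : ℝ) with hb
  set c := (nbrCount C x (-1 / 4) : ℝ) with hc
  set d := (nbrCount C x 0 : ℝ) with hd
  set e := (nbrCount C x (1 / 4) : ℝ) with he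
  set f := (nbrCount C x (1 / 2) : ℝ) with hf
  norm_num at e0 e1 e2 e3 e4 e5
  have ra : a = 1 := by
    linear_combination (1 / 90090) * e1 + (1 / 77220) * e3 + (2 / 135135) * e5
  have rb : b = 4600 := by
    linear_combination (-11 / 468) * e0 + (38 / 3003) * e1 + (-17 / 2772) * e2 + (1 / 468) * e3 +
      (-2 / 3003) * e4 + (-2 / 9009) * e5
  have rc : c = 47104 := by
    linear_combination (-28 / 117) * e0 + (592 / 9009) * e1 + (-4 / 693) * e2 + (-16 / 3861) * e3 +
      (8 / 3003) * e4 + (16 / 27027) * e5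
  have rd : d = 93150 := by
    linear_combination (-37 / 78) * e0 + (-1 / 2002) * e1 + (1 / 42) * e2 + (-1 / 1716) * e3 +
      (-4 / 1001) * e4 + (-2 / 3003) * e5
  have re : e = 47104 := by
    linear_combination (-28 / 117) * e0 + (-976 / 15015) * e1 + (-4 / 693) * e2 + (32 / 6435) * e3 +
      (8 / 3003) * e4 + (16 / 45045) * e5
  have rf : f = 4600 := by
    linear_combination (-11 / 468) * e0 + (-116 / 9009) * e1 + (-17 / 2772) * e2 + (-37 / 15444) * e3 +
      (-2 / 3003) * e4 + (-2 / 27027) * e5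
  rw [ha] at ra; rw [hb] at rb; rw [hc] at rc; rw [hd] at rd; rw [he] at re; rw [hf] at rf
  exact ⟨by exact_mod_cast ra, by exact_mod_cast rb, by exact_mod_cast rc, by exact_mod_cast rd,
    by exact_mod_cast re, by exact_mod_cast rf⟩

end perpoint

/-- **The Leech kissing configuration is distance-regular**: every one of its `196560` vectors has exactly
`4600` neighbours at `60°` (and `47104, 93150, 47104, 4600, 1` at the other five inner products).
[cite: ConwaySloane1999, Ch. 4 §11 Table 4.13] -/
theorem leech_nbrCount {x : E24} (hx : x ∈ leech) :
    nbrCount leech x (-1) = 1 ∧ nbrCount leech x (-1 / 2) = 4600 ∧ nbrCount leech x (-1 / 4) = 47104 ∧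
      nbrCount leech x 0 = 93150 ∧ nbrCount leech x (1 / 4) = 47104 ∧ nbrCount leech x (1 / 2) = 4600 :=
  nbrCount_eq norm_leech inner_leech card_leech hx

end Summit.Ventures.PackingBounds.Config.Leech
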